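import Literature.NumberTheory.EllipticCurves.BinaryQuarticMinimisation
import Literature.NumberTheory.EllipticCurves.BinaryQuarticDiscriminantStrata
import Mathlib.AlgebraicGeometry.EllipticCurve.Affine.Point
import HarnessLib

/-!
# Two-coverings attached to binary quartic forms, I: roots, the cubic resolvent and the
# `E[2]`-torsor of the roots

Topic `Literature/NumberTheory/EllipticCurves`. First file of the theory needed to *prove* the
named fact `Literature.NumberTheory.EllipticCurves.bhargavaShankar_card_selmerTwo_eq_kEquivClassCount`
(`BinaryQuarticMinimisation.lean`: Bhargava–Shankar, Ann. of Math. 181 (2015), held arXiv text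
§5.1, Lemma 5.2 and the sentence following it — the Birch–Swinnerton-Dyer correspondence between
the `2`-Selmer group of `E_{A,B}` and the equivalence classes of locally soluble binary quartic
forms with invariants `λ⁴I(E)`, `λ⁶J(E)`), for which Bhargava–Shankar print no proof (they cite
Birch–Swinnerton-Dyer, *Notes on elliptic curves. I*, Lemmas 1–2, and Cassels).

This file supplies, with complete proofs, the algebra underlying the map
"quartic `↦` Selmer class": for a binary quartic form `f` over a field `F` splitting as
`f = a ∏ᵢ (x − rᵢ y)` (`BinaryQuartic.RootData`, built on the tree's `BinaryQuartic.ofRoots`),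

* the **cubic resolvent**: for two roots `u ≠ v` put
  `φ(u, v) = 3a(u + v)² + 3b(u + v) + 2c` (`BinaryQuartic.phi`); then
  `φ(r₀, r₁) = 3a(r₀r₁ + r₂r₃) − c = φ(r₂, r₃)` and the three values `φ₁, φ₂, φ₃` attached to
  the three pairings of the roots satisfy `∏ₖ (X − φₖ) = X³ − 3I(f)X + J(f)`
  (`BinaryQuartic.resolvent_eq`), with `φ₁ − φ₂ = 3a(r₀ − r₃)(r₁ − r₂)` etc., so they are
  distinct when `Δ(f) ≠ 0` (Cremona, *Classical invariants and 2-descent on elliptic curves*,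
  J. Symbolic Comput. 31 (2001), §3: the resolvent cubic `F(X) = X³ − 3IX + J`, its root `φ`
  and the cubic seminvariant `z = a²(x₁ + x₂ − x₃ − x₄)² = (4aφ + p)/3` of (3.1) and Prop. 3.1 —
  our `φ(r₀, r₁)` is this `φ`; the cross-ratio of the roots is `(φ − φ″)/(φ′ − φ″)`, p. 77);
* the **`2`-torsion abscissae**: if `I(f) = −3At⁴`, `J(f) = −27Bt⁶` (`t ≠ 0`), then
  `x(u, v) = −φ(u, v)/(3t²)` is a root of `X³ + AX + B` (`BinaryQuartic.RootData.torsX_cubic`),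
  i.e. `(x(u, v), 0) ∈ E_{A,B}[2]` (Cremona 2001, §4: on `E_{I,J} : Y² = X³ − 27IX − 27J` the
  points of order `2` are `(−3φ, 0)`, p. 82; and `E_{I,J} ≅ E_{A,B}` by `(X, Y) = (9t²x, 27t³y)`);
* the **torsor structure** on the roots: `T(u, v) = (x(u, v), 0) ∈ E_{A,B}(F)` for roots `u ≠ v`,
  `T(u, u) = O` (`TwoCovering.torsorPt`), which is symmetric, `2`-torsion, and satisfies Chasles'
  relation `T(u, v) + T(v, w) = T(u, w)` (`TwoCovering.torsorPt_add_torsorPt`) — this is the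
  structure of principal homogeneous space of the curve `z² = f(x, y)` over `E_{A,B}`, restricted
  to its four ramification points `(rᵢ : 1 : 0)`, whose pairwise differences are the `2`-torsion
  points (Cremona 2001, Prop. 4.3 (3) and §5: `θ^σ = θ + T_σ` with `σ ↦ T_σ ∈ E[2]` a cocycle
  representing the `2`-covering in `H¹(Gal(K̄/K), E[2])`, where `θ` maps `(x₁, 0)` to `O` and the
  other `(x_j, 0)` to the points of order `2`, p. 82; Cassels, *Lectures on Elliptic Curves*, §22,
  Theorem: the class of a principal homogeneous space `(𝒟, Δ)` is the cocycle `{Δ(α, σα)}_σ` for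
  any algebraic point `α` of `𝒟`);
* functoriality of all of this in field homomorphisms (`torsorPt_map`), and the existence of
  root data over an algebraically closed field (`RootData.nonempty`).

The sequel files build from `T` the continuous `1`-cocycle `σ ↦ T(r₀, σ r₀)` of `Gal(F̄/K)` with
values in `E[2]`, its class in `H¹`, and the correspondence itself.

## References

* M. Bhargava, A. Shankar, Ann. of Math. (2) 181 (2015) 191–242, §5.1 of arXiv:1006.1002v2
  (Lemma 5.2 and the definition of `I(E) = −3A`, `J(E) = −27B`). [BhargavaShankarAnnals2015]
* J. E. Cremona, *Classical invariants and 2-descent on elliptic curves*, J. Symbolic Comput. 31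
  (2001) 71–87 (held, doi:10.1006/jsco.1998.1004), §2 (invariants `I`, `J`, covariants, syzygy
  (2.3)), §3 (resolvent cubic, (3.1), Prop. 3.1, Prop. 3.2), §4 (`E_{I,J}`, Prop. 4.3), §5.
  [Cremona2001]
* B. J. Birch, H. P. F. Swinnerton-Dyer, *Notes on elliptic curves. I*, J. reine angew. Math. 212
  (1963) 7–25, §2 and Lemmas 1–2. [BirchSwinnertonDyer1963]
* J. W. S. Cassels, *Lectures on Elliptic Curves*, LMS Student Texts 24 (1991), §22.

## Design

* `RootData f` records an (ordered, `Fin 4`-indexed) splitting `f = a ∏ᵢ (x − rᵢ y)` in terms of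
  the tree's `BinaryQuartic.ofRoots` (`BinaryQuarticDiscriminantStrata.lean`, whose
  `exists_eq_ofRoots` gives existence over an algebraically closed field); all identities are
  proved for `ofRootVec a r = ofRoots a (r 0) (r 1) (r 2) (r 3)` by `ring` and transported along
  `RootData.eq_ofRoots`. Re-indexing by `S₄` (`RootData.reindex`) reduces statements about
  arbitrary roots to the indices `0, 1, 2, 3`.
* `torsorPt` is defined for an arbitrary affine Weierstrass curve `C` over `F` as a total function
  (value `O` unless `u ≠ v` and `(x(u,v), 0)` is a nonsingular point of `C`); the lemmas assume
  `C` is the short model `y² = x³ + Ax + B` (`IsShortModel`). Instantiated at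
  `C = E_{A,B} ⁄ F̄` this is a point of the tree's `geomPoints` / `localPoints`.
-/

noncomputable section

open scoped Classical
open Polynomial

namespace Literature.NumberTheory.EllipticCurves

namespace BinaryQuartic

/-! ## §1 Root data -/

section Roots

variable {F S : Type*} [Field F] [Field S]

/-- Shorthand: the form `a ∏ᵢ (x − rᵢ y)` with roots indexed by `Fin 4` (the tree's
`BinaryQuartic.ofRoots` of `BinaryQuarticDiscriminantStrata.lean`). [folklore] -/
abbrev ofRootVec (a : F) (r : Fin 4 → F) : BinaryQuartic F :=
  ofRoots a (r 0) (r 1) (r 2) (r 3)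

/-- The dehomogenisation of `a ∏ᵢ (x − rᵢ y)` is `a ∏ᵢ (X − rᵢ)`. [folklore] -/
theorem toPoly_ofRootVec (a : F) (r : Fin 4 → F) :
    (ofRootVec a r).toPoly = C a * ∏ i, (X - C (r i)) := by
  rw [Fin.prod_univ_four]
  simp only [ofRootVec, ofRoots, toPoly, map_neg, map_mul, map_add]
  ring

/-- `ofRoots` commutes with ring homomorphisms. [folklore] -/
theorem map_ofRootVec (ψ : F →+* S) (a : F) (r : Fin 4 → F) :
    (ofRootVec a r).map ψ = ofRootVec (ψ a) (ψ ∘ r) := by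
  ext <;> simp [ofRoots, BinaryQuartic.map]

/-- The coefficients of `toPoly` (local helper). [folklore] -/
private theorem coeff_toPoly_eq (f : BinaryQuartic F) :
    f.toPoly.coeff 4 = f.a ∧ f.toPoly.coeff 3 = f.b ∧ f.toPoly.coeff 2 = f.c ∧
      f.toPoly.coeff 1 = f.d ∧ f.toPoly.coeff 0 = f.e := by
  refine ⟨?_, ?_, ?_, ?_, ?_⟩ <;> simp [toPoly, coeff_X_pow]

/-- `toPoly` is injective (local copy of the tree's `BinaryQuartic.toPoly_injective` of
`BhargavaShankarCountingProofs.lean`, not imported here to keep the import graph light). [folklore] -/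
private theorem toPoly_injective_aux : Function.Injective (toPoly : BinaryQuartic F → F[X]) := by
  intro f g h
  obtain ⟨h4, h3, h2, h1, h0⟩ := coeff_toPoly_eq f
  obtain ⟨g4, g3, g2, g1, g0⟩ := coeff_toPoly_eq g
  rw [h] at h4 h3 h2 h1 h0
  ext
  · rw [← h4, g4]
  · rw [← h3, g3]
  · rw [← h2, g2]
  · rw [← h1, g1]
  · rw [← h0, g0]

/-- `a ∏ᵢ (x − r_{σ i} y) = a ∏ᵢ (x − rᵢ y)`: re-ordering the roots does not change the form. [folklore] -/
theorem ofRootVec_comp_perm (a : F) (r : Fin 4 → F) (σ : Equiv.Perm (Fin 4)) :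
    ofRootVec a (r ∘ σ) = ofRootVec a r := by
  apply toPoly_injective_aux
  rw [toPoly_ofRootVec, toPoly_ofRootVec, Function.comp_def]
  congr 1
  exact Equiv.prod_comp σ (fun i ↦ X - C (r i))

/-- **Root data**: an ordered splitting `f = a ∏ᵢ (x − rᵢ y)` of a binary quartic form over a
field (`a = f.a`; the tree's `ofRoots`, roots indexed by `Fin 4`). Over an algebraically closed
field every form with `a ≠ 0` has root data (`RootData.nonempty`, from `exists_eq_ofRoots`).
[folklore] -/
structure RootData (f : BinaryQuartic F) where
  /-- the roots `r₀, r₁, r₂, r₃` of `f(x, 1)` -/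
  r : Fin 4 → F
  /-- `f = a ∏ᵢ (x − rᵢ y)` -/
  eq_ofRoots : f = ofRootVec f.a r

namespace RootData

variable {f : BinaryQuartic F} (R : RootData f)

/-- `f(x, y) = a ∏ᵢ (x − rᵢ y)`. [folklore] -/
theorem eval_eq (x y : F) :
    f.eval x y = f.a * (x - R.r 0 * y) * (x - R.r 1 * y) * (x - R.r 2 * y) * (x - R.r 3 * y) := by
  conv_lhs => rw [R.eq_ofRoots]
  rw [ofRootVec, eval_ofRoots]

/-- Each `rᵢ` is a root of `f(x, 1)`. [folklore] -/
theorem eval_r (i : Fin 4) : f.eval (R.r i) 1 = 0 := by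
  rw [R.eval_eq]
  fin_cases i <;> simp

/-- For `a ≠ 0`, the roots of `f(x, 1)` are exactly the `rᵢ`. [folklore] -/
theorem eval_eq_zero_iff (ha : f.a ≠ 0) (u : F) :
    f.eval u 1 = 0 ↔ u = R.r 0 ∨ u = R.r 1 ∨ u = R.r 2 ∨ u = R.r 3 := by
  rw [R.eval_eq, mul_one, mul_one, mul_one, mul_one]
  simp only [mul_eq_zero, sub_eq_zero, or_assoc, ha, false_or]

/-- For `a ≠ 0`, the roots of `f(x, 1)` are exactly the `rᵢ` (indexed form). [folklore] -/
theorem eval_eq_zero_iff' (ha : f.a ≠ 0) (u : F) : f.eval u 1 = 0 ↔ ∃ i, u = R.r i := by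
  rw [R.eval_eq_zero_iff ha]
  constructor
  · rintro (h | h | h | h) <;> exact ⟨_, h⟩
  · rintro ⟨i, rfl⟩
    fin_cases i <;> simp

/-- `Δ(f) = a⁶ ∏_{i<j} (rᵢ − rⱼ)²`. [folklore] -/
theorem disc_eq : f.disc = f.a ^ 6 * ((R.r 0 - R.r 1) * (R.r 0 - R.r 2) * (R.r 0 - R.r 3) *
    (R.r 1 - R.r 2) * (R.r 1 - R.r 3) * (R.r 2 - R.r 3)) ^ 2 := by
  conv_lhs => rw [R.eq_ofRoots]
  rw [ofRootVec, disc_ofRoots]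

/-- If `Δ(f) ≠ 0` the roots are pairwise distinct. [folklore] -/
theorem injective (hΔ : f.disc ≠ 0) : Function.Injective R.r := by
  intro i j hij
  by_contra hne
  apply hΔ
  rw [R.disc_eq]
  have key : (R.r 0 - R.r 1) * (R.r 0 - R.r 2) * (R.r 0 - R.r 3) * (R.r 1 - R.r 2) *
      (R.r 1 - R.r 3) * (R.r 2 - R.r 3) = 0 := by
    fin_cases i <;> fin_cases j <;> simp_all
  rw [key]; ring

/-- Root data is preserved by field homomorphisms. [folklore] -/
def map (ψ : F →+* S) : RootData (f.map ψ) where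
  r := ψ ∘ R.r
  eq_ofRoots := by
    conv_lhs => rw [R.eq_ofRoots]
    rw [map_ofRootVec]; rfl

/-- The roots of the mapped data are the images of the roots (definitional). [folklore] -/
@[simp] theorem map_r (ψ : F →+* S) (i : Fin 4) : (R.map ψ).r i = ψ (R.r i) := rfl

/-- Re-ordering root data by a permutation of the indices. [folklore] -/
def reindex (σ : Equiv.Perm (Fin 4)) : RootData f where
  r := R.r ∘ σ
  eq_ofRoots := by
    conv_lhs => rw [R.eq_ofRoots]
    rw [ofRootVec_comp_perm]

/-- The roots of re-ordered root data (definitional). [folklore] -/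
@[simp] theorem reindex_r (σ : Equiv.Perm (Fin 4)) (i : Fin 4) : (R.reindex σ).r i = R.r (σ i) := rfl

/-- Any three distinct indices are the images of `0, 1, 2` under a permutation of `Fin 4`. [folklore] -/
theorem _root_.Literature.NumberTheory.EllipticCurves.BinaryQuartic.exists_perm_fin_four
    {i j k : Fin 4} (hij : i ≠ j) (hjk : j ≠ k) (hik : i ≠ k) :
    ∃ σ : Equiv.Perm (Fin 4), σ 0 = i ∧ σ 1 = j ∧ σ 2 = k := by
  revert i j k
  decide

/-- Existence of root data over an algebraically closed field, for `a ≠ 0` (the tree's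
`exists_eq_ofRoots`). [folklore] -/
theorem nonempty [IsAlgClosed F] (ha : f.a ≠ 0) : Nonempty (RootData f) := by
  obtain ⟨a, r₁, r₂, r₃, r₄, -, hf⟩ := exists_eq_ofRoots f ha
  have ha' : f.a = a := by rw [hf]; rfl
  exact ⟨⟨![r₁, r₂, r₃, r₄], by rw [ha']; exact hf⟩⟩

end RootData

end Roots

/-! ## §2 The cubic resolvent -/

section Resolvent

variable {F S : Type*} [Field F] [Field S]

/-- The resolvent value attached to a pair of roots `u, v` of `f(x, 1)`:
`φ(u, v) = 3a(u + v)² + 3b(u + v) + 2c`; for root data, `φ(r₀, r₁) = 3a(r₀r₁ + r₂r₃) − c`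
(`phi_pair_ofRoots`), the root of the resolvent cubic `F(X) = X³ − 3IX + J` attached to the
pairing `{r₀, r₁} | {r₂, r₃}`: in Cremona's notation `z = a²(x₁ + x₂ − x₃ − x₄)² = (4aφ + p)/3`
(Cremona 2001, §3, (3.1) and Prop. 3.1). [cite: Cremona2001, §3 (3.1) and Prop. 3.1] -/
def phi (f : BinaryQuartic F) (u v : F) : F :=
  3 * f.a * (u + v) ^ 2 + 3 * f.b * (u + v) + 2 * f.c

/-- `φ` is symmetric. [folklore] -/
theorem phi_comm (f : BinaryQuartic F) (u v : F) : phi f u v = phi f v u := by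
  rw [phi, phi, add_comm u v]

/-- `φ` commutes with field homomorphisms. [folklore] -/
theorem phi_map (ψ : F →+* S) (f : BinaryQuartic F) (u v : F) :
    phi (f.map ψ) (ψ u) (ψ v) = ψ (phi f u v) := by
  simp [phi, BinaryQuartic.map, map_ofNat]

/-- `φ(r₀, r₁) = 3a(r₀r₁ + r₂r₃) − c`. [cite: Cremona2001, §3 (3.1) and Prop. 3.1] -/
theorem phi_pair_ofRoots (a : F) (r : Fin 4 → F) :
    phi (ofRootVec a r) (r 0) (r 1) = 3 * a * (r 0 * r 1 + r 2 * r 3) - (ofRootVec a r).c := by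
  simp only [phi, ofRootVec, ofRoots]; ring

/-- `φ` takes the same value on complementary pairs: `φ(r₀, r₁) = φ(r₂, r₃)`. [folklore] -/
theorem phi_compl_ofRoots (a : F) (r : Fin 4 → F) :
    phi (ofRootVec a r) (r 2) (r 3) = phi (ofRootVec a r) (r 0) (r 1) := by
  simp only [phi, ofRootVec, ofRoots]; ring

/-- **The cubic resolvent.** With `φ₁ = φ(r₀,r₁)`, `φ₂ = φ(r₀,r₂)`, `φ₃ = φ(r₀,r₃)`:
`(X − φ₁)(X − φ₂)(X − φ₃) = X³ − 3I(f)X + J(f)` identically: the `φₖ` are the three roots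
`φ, φ′, φ″` of Cremona's resolvent cubic `F(X) = X³ − 3IX + J` (Cremona 2001, §3 and Prop. 3.1,
via `z = (4aφ + p)/3`). [cite: Cremona2001, §3 (F(X) = X³ − 3IX + J) and Prop. 3.1] -/
theorem resolvent_eq_ofRoots (a : F) (r : Fin 4 → F) (X : F) :
    (X - phi (ofRootVec a r) (r 0) (r 1)) * (X - phi (ofRootVec a r) (r 0) (r 2)) *
      (X - phi (ofRootVec a r) (r 0) (r 3)) =
      X ^ 3 - 3 * (ofRootVec a r).I * X + (ofRootVec a r).J := by
  simp only [phi, ofRootVec, ofRoots, BinaryQuartic.I, BinaryQuartic.J]; ring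

/-- Vieta for the resolvent: `φ₁ + φ₂ + φ₃ = 0`. [folklore] -/
theorem phi_sum_ofRoots (a : F) (r : Fin 4 → F) :
    phi (ofRootVec a r) (r 0) (r 1) + phi (ofRootVec a r) (r 0) (r 2) +
      phi (ofRootVec a r) (r 0) (r 3) = 0 := by
  simp only [phi, ofRootVec, ofRoots]; ring

/-- Vieta for the resolvent: `φ₁φ₂ + φ₁φ₃ + φ₂φ₃ = −3I(f)`. [folklore] -/
theorem phi_sum_mul_ofRoots (a : F) (r : Fin 4 → F) :
    phi (ofRootVec a r) (r 0) (r 1) * phi (ofRootVec a r) (r 0) (r 2) +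
      phi (ofRootVec a r) (r 0) (r 1) * phi (ofRootVec a r) (r 0) (r 3) +
      phi (ofRootVec a r) (r 0) (r 2) * phi (ofRootVec a r) (r 0) (r 3) = -3 * (ofRootVec a r).I := by
  simp only [phi, ofRootVec, ofRoots, BinaryQuartic.I]; ring

/-- Differences of resolvent values: `φ₁ − φ₂ = 3a(r₀ − r₃)(r₁ − r₂)` (so that the cross-ratio
of the roots is a ratio of differences of the `φₖ`, Cremona 2001, §3, p. 77). [cite: Cremona2001, §3 p. 77 (cross-ratio of the roots)] -/
theorem phi_sub_phi_12_ofRoots (a : F) (r : Fin 4 → F) :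
    phi (ofRootVec a r) (r 0) (r 1) - phi (ofRootVec a r) (r 0) (r 2) =
      3 * a * (r 0 - r 3) * (r 1 - r 2) := by
  simp only [phi, ofRootVec, ofRoots]; ring

/-- Differences of resolvent values: `φ₁ − φ₃ = 3a(r₀ − r₂)(r₁ − r₃)`. [cite: Cremona2001, §3 p. 77 (cross-ratio of the roots)] -/
theorem phi_sub_phi_13_ofRoots (a : F) (r : Fin 4 → F) :
    phi (ofRootVec a r) (r 0) (r 1) - phi (ofRootVec a r) (r 0) (r 3) =
      3 * a * (r 0 - r 2) * (r 1 - r 3) := by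
  simp only [phi, ofRootVec, ofRoots]; ring

/-- Differences of resolvent values: `φ₂ − φ₃ = 3a(r₀ − r₁)(r₂ − r₃)`. [cite: Cremona2001, §3 p. 77 (cross-ratio of the roots)] -/
theorem phi_sub_phi_23_ofRoots (a : F) (r : Fin 4 → F) :
    phi (ofRootVec a r) (r 0) (r 2) - phi (ofRootVec a r) (r 0) (r 3) =
      3 * a * (r 0 - r 1) * (r 2 - r 3) := by
  simp only [phi, ofRootVec, ofRoots]; ring

/-- For any two indices `i ≠ j`, `φ(rᵢ, rⱼ)` is one of `φ₁, φ₂, φ₃` (the value attached to the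
pairing containing `{rᵢ, rⱼ}`). [folklore] -/
theorem phi_mem_ofRoots (a : F) (r : Fin 4 → F) {i j : Fin 4} (hij : i ≠ j) :
    phi (ofRootVec a r) (r i) (r j) = phi (ofRootVec a r) (r 0) (r 1) ∨
      phi (ofRootVec a r) (r i) (r j) = phi (ofRootVec a r) (r 0) (r 2) ∨
      phi (ofRootVec a r) (r i) (r j) = phi (ofRootVec a r) (r 0) (r 3) := by
  fin_cases i <;> fin_cases j <;> simp at hij ⊢ <;>
    first
    | exact Or.inl (by simp only [phi, ofRootVec, ofRoots]; ring1)
    | exact Or.inr (Or.inl (by simp only [phi, ofRootVec, ofRoots]; ring1))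
    | exact Or.inr (Or.inr (by simp only [phi, ofRootVec, ofRoots]; ring1))

end Resolvent

/-! ## §3 The `2`-torsion abscissae -/

section Torsion

variable {F S : Type*} [Field F] [Field S]

/-- The `2`-torsion abscissa attached to a pair of roots: `x(u, v) = −φ(u, v)/(3t²)`. If
`I(f) = −3At⁴` and `J(f) = −27Bt⁶` then, for roots `u ≠ v` of `f(x,1)`, `x(u, v)` is a root of
`X³ + AX + B`, i.e. `(x(u,v), 0)` is a `2`-torsion point of `E_{A,B} : y² = x³ + Ax + B`
(`RootData.torsX_cubic`). (Bhargava–Shankar attach to `E_{A,B}` the invariants `I(E) = −3A`,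
`J(E) = −27B`, §5 of the held text, and the `2`-covering `z² = f` with invariants `λ⁴I(E)`,
`λ⁶J(E)` has `λ = t`; on Cremona's `E_{I,J} : Y² = X³ − 27IX − 27J` the points of order `2` are
`(−3φ, 0)` (Cremona 2001, §4, p. 82), and `(X, Y) = (9t²x, 27t³y)` identifies `E_{I,J}` with
`E_{A,B}`.) [cite: Cremona2001, §4 p. 82 (2-torsion points (−3φ, 0) of E_{I,J})] -/
def torsX (f : BinaryQuartic F) (t u v : F) : F :=
  -phi f u v / (3 * t ^ 2)

/-- `x(u, v)` is symmetric. [folklore] -/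
theorem torsX_comm (f : BinaryQuartic F) (t u v : F) : torsX f t u v = torsX f t v u := by
  rw [torsX, torsX, phi_comm]

/-- `x(u, v)` commutes with field homomorphisms. [folklore] -/
theorem torsX_map (ψ : F →+* S) (f : BinaryQuartic F) (t u v : F) :
    torsX (f.map ψ) (ψ t) (ψ u) (ψ v) = ψ (torsX f t u v) := by
  simp [torsX, phi_map, map_ofNat]

/-- From the resolvent cubic to the curve: if `φ³ − 3Iφ + J = 0` with `I = −3At⁴`, `J = −27Bt⁶`,
`t ≠ 0`, `3 ≠ 0`, then `x = −φ/(3t²)` satisfies `x³ + Ax + B = 0`. [folklore] -/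
theorem cubic_of_resolvent {A B t φ : F} (h3 : (3 : F) ≠ 0) (ht : t ≠ 0)
    (h : φ ^ 3 - 3 * (-3 * A * t ^ 4) * φ + -27 * B * t ^ 6 = 0) :
    (-φ / (3 * t ^ 2)) ^ 3 + A * (-φ / (3 * t ^ 2)) + B = 0 := by
  have ht2 : (3 * t ^ 2) ≠ 0 := mul_ne_zero h3 (pow_ne_zero _ ht)
  field_simp
  linear_combination (-1 : F) * h

namespace RootData

variable {f : BinaryQuartic F} (R : RootData f)

/-- Each resolvent value `φ(r₀, r_k)`, `k = 1, 2, 3`, is a root of `X³ − 3I(f)X + J(f)`. [cite: Cremona2001, §3 (resolvent cubic) and Prop. 3.1] -/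
theorem phi_zero_resolvent (k : Fin 4) (hk : k ≠ 0) :
    phi f (R.r 0) (R.r k) ^ 3 - 3 * f.I * phi f (R.r 0) (R.r k) + f.J = 0 := by
  have h := resolvent_eq_ofRoots f.a R.r (phi f (R.r 0) (R.r k))
  rw [← R.eq_ofRoots] at h
  rw [← h]
  fin_cases k
  · exact absurd rfl hk
  · simp
  · simp
  · simp

/-- For any two distinct roots, `φ(rᵢ, rⱼ)` is a root of the resolvent cubic
`X³ − 3I(f)X + J(f)`. [cite: Cremona2001, §3 (resolvent cubic) and Prop. 3.1] -/
theorem phi_resolvent {i j : Fin 4} (hij : i ≠ j) :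
    phi f (R.r i) (R.r j) ^ 3 - 3 * f.I * phi f (R.r i) (R.r j) + f.J = 0 := by
  have hm := phi_mem_ofRoots f.a R.r hij
  rw [← R.eq_ofRoots] at hm
  rcases hm with h | h | h <;> rw [h]
  · exact R.phi_zero_resolvent 1 (by decide)
  · exact R.phi_zero_resolvent 2 (by decide)
  · exact R.phi_zero_resolvent 3 (by decide)

/-- **The `2`-torsion abscissae lie on the curve**: for distinct roots `rᵢ ≠ rⱼ` (as indices) of a
form with `I(f) = −3At⁴`, `J(f) = −27Bt⁶`, `x(rᵢ, rⱼ)³ + A·x(rᵢ, rⱼ) + B = 0`.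
[cite: Cremona2001, §4 p. 82 (2-torsion points (−3φ, 0) of E_{I,J})] -/
theorem torsX_cubic {A B t : F} (h3 : (3 : F) ≠ 0) (ht : t ≠ 0) (hI : f.I = -3 * A * t ^ 4)
    (hJ : f.J = -27 * B * t ^ 6) {i j : Fin 4} (hij : i ≠ j) :
    torsX f t (R.r i) (R.r j) ^ 3 + A * torsX f t (R.r i) (R.r j) + B = 0 := by
  have h := R.phi_resolvent hij
  rw [hI, hJ] at h
  exact cubic_of_resolvent h3 ht (by linear_combination h)

/-- `φ(r₀,r₁) ≠ φ(r₀,r₂)` when `Δ(f) ≠ 0` (and `a ≠ 0`, `3 ≠ 0`). [folklore] -/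
theorem phi01_ne_phi02 (ha : f.a ≠ 0) (h3 : (3 : F) ≠ 0) (hΔ : f.disc ≠ 0) :
    phi f (R.r 0) (R.r 1) ≠ phi f (R.r 0) (R.r 2) := by
  intro h
  have hd := phi_sub_phi_12_ofRoots f.a R.r
  rw [← R.eq_ofRoots, h, sub_self] at hd
  have hinj := R.injective hΔ
  have h03 : R.r 0 - R.r 3 ≠ 0 := sub_ne_zero.mpr fun h' ↦ by simpa using hinj h'
  have h12 : R.r 1 - R.r 2 ≠ 0 := sub_ne_zero.mpr fun h' ↦ by simpa using hinj h'
  exact mul_ne_zero (mul_ne_zero (mul_ne_zero h3 ha) h03) h12 hd.symm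

/-- `φ(r₀,r₁) ≠ φ(r₀,r₃)` when `Δ(f) ≠ 0`. [folklore] -/
theorem phi01_ne_phi03 (ha : f.a ≠ 0) (h3 : (3 : F) ≠ 0) (hΔ : f.disc ≠ 0) :
    phi f (R.r 0) (R.r 1) ≠ phi f (R.r 0) (R.r 3) := by
  intro h
  have hd := phi_sub_phi_13_ofRoots f.a R.r
  rw [← R.eq_ofRoots, h, sub_self] at hd
  have hinj := R.injective hΔ
  have h02 : R.r 0 - R.r 2 ≠ 0 := sub_ne_zero.mpr fun h' ↦ by simpa using hinj h'
  have h13 : R.r 1 - R.r 3 ≠ 0 := sub_ne_zero.mpr fun h' ↦ by simpa using hinj h'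
  exact mul_ne_zero (mul_ne_zero (mul_ne_zero h3 ha) h02) h13 hd.symm

/-- `φ(r₀,r₂) ≠ φ(r₀,r₃)` when `Δ(f) ≠ 0`. [folklore] -/
theorem phi02_ne_phi03 (ha : f.a ≠ 0) (h3 : (3 : F) ≠ 0) (hΔ : f.disc ≠ 0) :
    phi f (R.r 0) (R.r 2) ≠ phi f (R.r 0) (R.r 3) := by
  intro h
  have hd := phi_sub_phi_23_ofRoots f.a R.r
  rw [← R.eq_ofRoots, h, sub_self] at hd
  have hinj := R.injective hΔ
  have h01 : R.r 0 - R.r 1 ≠ 0 := sub_ne_zero.mpr fun h' ↦ by simpa using hinj h'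
  have h23 : R.r 2 - R.r 3 ≠ 0 := sub_ne_zero.mpr fun h' ↦ by simpa using hinj h'
  exact mul_ne_zero (mul_ne_zero (mul_ne_zero h3 ha) h01) h23 hd.symm

/-- `φ(r₁, r₂) = φ(r₀, r₃)` (complementary pairs), for `ofRoots`. [folklore] -/
theorem _root_.Literature.NumberTheory.EllipticCurves.BinaryQuartic.phi12_eq_phi03_ofRoots (a : F)
    (r : Fin 4 → F) : phi (ofRootVec a r) (r 1) (r 2) = phi (ofRootVec a r) (r 0) (r 3) := by
  simp only [phi, ofRootVec, ofRoots]; ring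

/-- `φ(r₁, r₂) = φ(r₀, r₃)` (complementary pairs). [folklore] -/
theorem phi12_eq_phi03 : phi f (R.r 1) (R.r 2) = phi f (R.r 0) (R.r 3) := by
  have h := phi12_eq_phi03_ofRoots f.a R.r
  rwa [← R.eq_ofRoots] at h

/-- `φ(r₀, r₁) + φ(r₁, r₂) + φ(r₀, r₂) = 0`, for `ofRoots`. [folklore] -/
theorem _root_.Literature.NumberTheory.EllipticCurves.BinaryQuartic.phi01_add_phi12_add_phi02_ofRoots
    (a : F) (r : Fin 4 → F) :
    phi (ofRootVec a r) (r 0) (r 1) + phi (ofRootVec a r) (r 1) (r 2) +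
      phi (ofRootVec a r) (r 0) (r 2) = 0 := by
  simp only [phi, ofRootVec, ofRoots]; ring

/-- The resolvent values of the three pairings sum to zero:
`φ(r₀, r₁) + φ(r₁, r₂) + φ(r₀, r₂) = 0`. [folklore] -/
theorem phi01_add_phi12_add_phi02 :
    phi f (R.r 0) (R.r 1) + phi f (R.r 1) (R.r 2) + phi f (R.r 0) (R.r 2) = 0 := by
  have h := phi01_add_phi12_add_phi02_ofRoots f.a R.r
  rwa [← R.eq_ofRoots] at h

/-- `3x(r₀,r₁)² − I/(3t⁴) = (x(r₀,r₁) − x(r₀,r₂))(x(r₀,r₁) − x(r₀,r₃))`, for `ofRoots`. [folklore] -/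
theorem _root_.Literature.NumberTheory.EllipticCurves.BinaryQuartic.three_mul_torsX_sq_add_ofRoots
    (a : F) (r : Fin 4 → F) (h3 : (3 : F) ≠ 0) {t : F} (ht : t ≠ 0) :
    3 * torsX (ofRootVec a r) t (r 0) (r 1) ^ 2 + -(ofRootVec a r).I / (3 * t ^ 4) =
      (torsX (ofRootVec a r) t (r 0) (r 1) - torsX (ofRootVec a r) t (r 0) (r 2)) *
        (torsX (ofRootVec a r) t (r 0) (r 1) - torsX (ofRootVec a r) t (r 0) (r 3)) := by
  simp only [torsX, phi, ofRootVec, ofRoots, BinaryQuartic.I]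
  have ht2 : (3 * t ^ 2) ≠ 0 := mul_ne_zero h3 (pow_ne_zero _ ht)
  have ht4 : (3 * t ^ 4) ≠ 0 := mul_ne_zero h3 (pow_ne_zero _ ht)
  field_simp
  ring

/-- The derivative of `X³ + AX + B` at `x(r₀,r₁)` factors through the other two torsion abscissae:
`3x(r₀,r₁)² + A = (x(r₀,r₁) − x(r₀,r₂))(x(r₀,r₁) − x(r₀,r₃))` (the three `x(r₀,r_k)` being
the roots of `X³ + AX + B`). [folklore] -/
theorem three_mul_torsX_sq_add (h3 : (3 : F) ≠ 0) {A t : F} (ht : t ≠ 0)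
    (hI : f.I = -3 * A * t ^ 4) :
    3 * torsX f t (R.r 0) (R.r 1) ^ 2 + A =
      (torsX f t (R.r 0) (R.r 1) - torsX f t (R.r 0) (R.r 2)) *
        (torsX f t (R.r 0) (R.r 1) - torsX f t (R.r 0) (R.r 3)) := by
  have ht4 : (3 * t ^ 4) ≠ 0 := mul_ne_zero h3 (pow_ne_zero _ ht)
  have hA : A = -f.I / (3 * t ^ 4) := by
    rw [hI]; field_simp
  rw [hA]
  have h := three_mul_torsX_sq_add_ofRoots f.a R.r h3 ht
  rwa [← R.eq_ofRoots] at h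

/-- Nonvanishing of `3x² + A` at the torsion abscissa `x(r₀, r₁)` when `Δ(f) ≠ 0`: the `2`-torsion
points `(x, 0)` are nonsingular points of `E_{A,B}`. [folklore] -/
theorem three_mul_torsX_sq_add_ne_zero (ha : f.a ≠ 0) (h3 : (3 : F) ≠ 0) (hΔ : f.disc ≠ 0)
    {A t : F} (ht : t ≠ 0) (hI : f.I = -3 * A * t ^ 4) :
    3 * torsX f t (R.r 0) (R.r 1) ^ 2 + A ≠ 0 := by
  rw [R.three_mul_torsX_sq_add h3 ht hI]
  have ht2 : (3 * t ^ 2) ≠ 0 := mul_ne_zero h3 (pow_ne_zero _ ht)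
  refine mul_ne_zero (sub_ne_zero.mpr fun h ↦ ?_) (sub_ne_zero.mpr fun h ↦ ?_)
  · exact R.phi01_ne_phi02 ha h3 hΔ (by simpa [torsX, div_left_inj' ht2, neg_inj] using h)
  · exact R.phi01_ne_phi03 ha h3 hΔ (by simpa [torsX, div_left_inj' ht2, neg_inj] using h)

end RootData

end Torsion

end BinaryQuartic

/-! ## §4 The `E[2]`-torsor of the roots -/

namespace TwoCovering

open BinaryQuartic WeierstrassCurve WeierstrassCurve.Affine

variable {F : Type*} [Field F]

/-- `C` is the short Weierstrass model `y² = x³ + Ax + B` (all lemmas below are stated for an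
arbitrary affine Weierstrass curve satisfying this predicate, so that they apply verbatim to the
base changes `E_{A,B} ⁄ F̄` carrying the tree's Galois modules `geomPoints`, `localPoints`).
[folklore] -/
structure IsShortModel (C : Affine F) (A B : F) : Prop where
  /-- `a₁ = 0` -/
  a₁ : C.a₁ = 0
  /-- `a₂ = 0` -/
  a₂ : C.a₂ = 0
  /-- `a₃ = 0` -/
  a₃ : C.a₃ = 0
  /-- `a₄ = A` -/
  a₄ : C.a₄ = A
  /-- `a₆ = B` -/
  a₆ : C.a₆ = B

namespace IsShortModel

variable {C : Affine F} {A B : F} (hC : IsShortModel C A B)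
include hC

/-- On a short model, `(x, y) ∈ C ↔ y² = x³ + Ax + B`. [folklore] -/
theorem equation_iff (x y : F) : C.Equation x y ↔ y ^ 2 = x ^ 3 + A * x + B := by
  rw [Affine.equation_iff, hC.a₁, hC.a₂, hC.a₃, hC.a₄, hC.a₆]
  simp

/-- On a short model, `−(x, y) = (x, −y)`. [folklore] -/
theorem negY (x y : F) : C.negY x y = -y := by
  rw [Affine.negY, hC.a₁, hC.a₃]; ring

/-- On a short model, `(x, 0)` is a nonsingular point iff `x³ + Ax + B = 0` and `3x² + A ≠ 0`.
[folklore] -/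
theorem nonsingular_zero_iff (x : F) :
    C.Nonsingular x 0 ↔ x ^ 3 + A * x + B = 0 ∧ 3 * x ^ 2 + A ≠ 0 := by
  rw [Affine.nonsingular_iff, hC.equation_iff, hC.a₁, hC.a₂, hC.a₃, hC.a₄]
  constructor
  · rintro ⟨h1, h2⟩
    refine ⟨by linear_combination -h1, ?_⟩
    rcases h2 with h2 | h2
    · intro h; apply h2; linear_combination -h
    · exact absurd (by ring) h2
  · rintro ⟨h1, h2⟩
    exact ⟨by linear_combination -h1, Or.inl fun h ↦ h2 (by linear_combination -h)⟩

/-- The short model has discriminant `Δ = −16(4A³ + 27B²)`. [folklore] -/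
theorem Δ_eq : C.Δ = -16 * (4 * A ^ 3 + 27 * B ^ 2) := by
  simp only [WeierstrassCurve.Δ, WeierstrassCurve.b₂, WeierstrassCurve.b₄, WeierstrassCurve.b₆,
    WeierstrassCurve.b₈, hC.a₁, hC.a₂, hC.a₃, hC.a₄, hC.a₆]
  ring

end IsShortModel

/-- The base change `E_{A,B} ⁄ F` of `shortWeierstrass (A, B)` is a short model with the cast
coefficients. [folklore] -/
theorem isShortModel_baseChange (AB : ℤ × ℤ) (F : Type*) [Field F] [Algebra ℚ F] :
    IsShortModel ((shortWeierstrass AB).baseChange F).toAffine (AB.1 : F) (AB.2 : F) := by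
  refine ⟨?_, ?_, ?_, ?_, ?_⟩ <;> simp [shortWeierstrass, WeierstrassCurve.baseChange]

variable (C : Affine F)

/-- **The torsor difference of two roots.** For a binary quartic `f` over `F`, a scalar `t` and
`u, v ∈ F`: the point `T(u, v) = (x(u, v), 0) = (−φ(u,v)/(3t²), 0)` of `C` if `u ≠ v` and this is a
nonsingular point of `C`, and `O` otherwise (in particular `T(u, u) = O`). When `C` is
`E_{A,B} : y² = x³ + Ax + B`, `I(f) = −3At⁴`, `J(f) = −27Bt⁶` and `u, v` are roots of `f(x, 1)`,
`T(u, v) ∈ E_{A,B}[2]` is the difference "`(v : 1 : 0) − (u : 1 : 0)`" of the two ramification points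
of the `2`-covering `z² = f(x, y) → E_{A,B}` for its structure of principal homogeneous space
(Cremona 2001, §4: `θ₁` maps `(x₁, 0)` to `O` and the other `(x_j, 0)` to the points of order `2`,
p. 82; Prop. 4.3 (3) and §5: `σ ↦ T_σ` is a cocycle representing the `2`-covering in
`H¹(Gal(K̄/K), E[2])`; this is the correspondence of Bhargava–Shankar, Lemma 5.2).
[cite: Cremona2001, §4 Prop. 4.3 and §5 (the cocycle T_σ of a 2-covering)] -/
def torsorPt (f : BinaryQuartic F) (t u v : F) : C.Point :=
  if h : u ≠ v ∧ C.Nonsingular (torsX f t u v) 0 then .some _ _ h.2 else 0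

variable {C}

/-- `T(u, u) = O`. [folklore] -/
@[simp] theorem torsorPt_self (f : BinaryQuartic F) (t u : F) : torsorPt C f t u u = 0 := by
  simp [torsorPt]

/-- `T(u, v) = (x(u, v), 0)` when `u ≠ v` and the point is nonsingular. [folklore] -/
theorem torsorPt_of_nonsingular {f : BinaryQuartic F} {t u v : F} (huv : u ≠ v)
    (h : C.Nonsingular (torsX f t u v) 0) : torsorPt C f t u v = .some _ _ h := by
  rw [torsorPt, dif_pos ⟨huv, h⟩]

/-- `T(u, v)` is symmetric. [folklore] -/
theorem torsorPt_comm (f : BinaryQuartic F) (t u v : F) : torsorPt C f t u v = torsorPt C f t v u := by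
  by_cases h : u ≠ v ∧ C.Nonsingular (torsX f t u v) 0
  · have h' : v ≠ u ∧ C.Nonsingular (torsX f t v u) 0 := ⟨h.1.symm, torsX_comm f t u v ▸ h.2⟩
    rw [torsorPt, dif_pos h, torsorPt, dif_pos h']
    simp only [Point.some.injEq, and_true]
    exact torsX_comm f t u v
  · have h' : ¬(v ≠ u ∧ C.Nonsingular (torsX f t v u) 0) := fun h' ↦
      h ⟨h'.1.symm, torsX_comm f t v u ▸ h'.2⟩
    rw [torsorPt, dif_neg h, torsorPt, dif_neg h']

section Short

variable {A B : F} (hC : IsShortModel C A B)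
include hC

/-- `T(u, v)` is its own negative (it is `O` or a point with `y = 0` on a short model). [folklore] -/
theorem neg_torsorPt (f : BinaryQuartic F) (t u v : F) : -torsorPt C f t u v = torsorPt C f t u v := by
  by_cases h : u ≠ v ∧ C.Nonsingular (torsX f t u v) 0
  · rw [torsorPt, dif_pos h, Point.neg_some]
    simp only [Point.some.injEq, true_and]
    rw [hC.negY, neg_zero]
  · rw [torsorPt, dif_neg h, Point.neg_zero]

/-- `T(u, v)` is a `2`-torsion point: `T(u, v) + T(u, v) = O`. [folklore] -/
theorem torsorPt_add_self (f : BinaryQuartic F) (t u v : F) :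
    torsorPt C f t u v + torsorPt C f t u v = 0 := by
  by_cases h : u ≠ v ∧ C.Nonsingular (torsX f t u v) 0
  · rw [torsorPt, dif_pos h]
    exact Point.add_self_of_Y_eq (by rw [hC.negY, neg_zero])
  · rw [torsorPt, dif_neg h, add_zero]

/-- `2 • T(u, v) = O`. [folklore] -/
theorem two_nsmul_torsorPt (f : BinaryQuartic F) (t u v : F) : 2 • torsorPt C f t u v = 0 := by
  rw [two_nsmul, torsorPt_add_self hC]

variable {f : BinaryQuartic F} (R : RootData f) {t : F}

/-- For root data with `I(f) = −3At⁴`, `J(f) = −27Bt⁶`, `Δ(f) ≠ 0`: the torsion abscissa of two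
distinct roots gives a nonsingular point `(x(rᵢ, rⱼ), 0)` of `E_{A,B}`. [folklore] -/
theorem nonsingular_torsX (ha : f.a ≠ 0) (h3 : (3 : F) ≠ 0) (hΔ : f.disc ≠ 0) (ht : t ≠ 0)
    (hI : f.I = -3 * A * t ^ 4) (hJ : f.J = -27 * B * t ^ 6) {i j : Fin 4} (hij : i ≠ j) :
    C.Nonsingular (torsX f t (R.r i) (R.r j)) 0 := by
  rw [hC.nonsingular_zero_iff]
  refine ⟨R.torsX_cubic h3 ht hI hJ hij, ?_⟩
  -- reduce to the pair `(0, 1)` by re-indexing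
  obtain ⟨k, hki, hkj⟩ : ∃ k : Fin 4, k ≠ i ∧ k ≠ j := by
    revert i j; decide
  obtain ⟨σ, h0, h1, h2⟩ := exists_perm_fin_four hij hkj.symm hki.symm
  have h := (R.reindex σ).three_mul_torsX_sq_add_ne_zero ha h3 hΔ ht hI
  simpa [h0, h1] using h

/-- `T(rᵢ, rⱼ) = (x(rᵢ, rⱼ), 0)` for distinct indices. [folklore] -/
theorem torsorPt_eq_some (ha : f.a ≠ 0) (h3 : (3 : F) ≠ 0) (hΔ : f.disc ≠ 0) (ht : t ≠ 0)
    (hI : f.I = -3 * A * t ^ 4) (hJ : f.J = -27 * B * t ^ 6) {i j : Fin 4} (hij : i ≠ j) :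
    torsorPt C f t (R.r i) (R.r j) =
      .some _ _ (nonsingular_torsX hC R ha h3 hΔ ht hI hJ hij) :=
  torsorPt_of_nonsingular (fun h ↦ hij (R.injective hΔ h)) _

/-- **Chasles' relation for the pair `(r₀, r₁), (r₁, r₂)`**: `T(r₀, r₁) + T(r₁, r₂) = T(r₀, r₂)` —
the sum of the `2`-torsion points `(e, 0)`, `(e', 0)` with `e ≠ e'` is `(−e − e', 0)`, and the
three torsion abscissae of the three pairings sum to zero. [folklore] -/
theorem torsorPt_add_torsorPt_012 (ha : f.a ≠ 0) (h3 : (3 : F) ≠ 0) (hΔ : f.disc ≠ 0) (ht : t ≠ 0)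
    (hI : f.I = -3 * A * t ^ 4) (hJ : f.J = -27 * B * t ^ 6) :
    torsorPt C f t (R.r 0) (R.r 1) + torsorPt C f t (R.r 1) (R.r 2) =
      torsorPt C f t (R.r 0) (R.r 2) := by
  have ht2 : (3 * t ^ 2) ≠ 0 := mul_ne_zero h3 (pow_ne_zero _ ht)
  rw [torsorPt_eq_some hC R ha h3 hΔ ht hI hJ (show (0 : Fin 4) ≠ 1 by decide),
    torsorPt_eq_some hC R ha h3 hΔ ht hI hJ (show (1 : Fin 4) ≠ 2 by decide),
    torsorPt_eq_some hC R ha h3 hΔ ht hI hJ (show (0 : Fin 4) ≠ 2 by decide)]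
  have hx : torsX f t (R.r 0) (R.r 1) ≠ torsX f t (R.r 1) (R.r 2) := by
    intro h
    apply R.phi01_ne_phi03 ha h3 hΔ
    rw [← R.phi12_eq_phi03]
    simpa [torsX, div_left_inj' ht2, neg_inj] using h
  rw [Point.add_of_X_ne hx]
  have hsum : torsX f t (R.r 0) (R.r 1) + torsX f t (R.r 1) (R.r 2) + torsX f t (R.r 0) (R.r 2) = 0 := by
    have h := R.phi01_add_phi12_add_phi02
    simp only [torsX]
    field_simp
    linear_combination -h
  simp only [Point.some.injEq]
  constructor
  · rw [Affine.addX, Affine.slope_of_X_ne hx, hC.a₁, hC.a₂]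
    linear_combination -hsum
  · rw [Affine.addY, Affine.negAddY, Affine.addX, Affine.slope_of_X_ne hx, hC.negY]
    ring

/-- **Chasles' relation** `T(rᵢ, rⱼ) + T(rⱼ, r_k) = T(rᵢ, r_k)` for any three roots (the
`E[2]`-torsor structure on the roots: `T(u, v) = "v − u"`). Degenerate cases: `T(u,u) = O`,
`T(u,v) + T(v,u) = O`. [cite: Cremona2001, §4 Prop. 4.3 (3) and §5 (σ ↦ T_σ is a cocycle)] -/
theorem torsorPt_add_torsorPt (ha : f.a ≠ 0) (h3 : (3 : F) ≠ 0) (hΔ : f.disc ≠ 0) (ht : t ≠ 0)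
    (hI : f.I = -3 * A * t ^ 4) (hJ : f.J = -27 * B * t ^ 6) (i j k : Fin 4) :
    torsorPt C f t (R.r i) (R.r j) + torsorPt C f t (R.r j) (R.r k) =
      torsorPt C f t (R.r i) (R.r k) := by
  by_cases hij : i = j
  · subst hij; rw [torsorPt_self, zero_add]
  by_cases hjk : j = k
  · subst hjk; rw [torsorPt_self, add_zero]
  by_cases hik : i = k
  · subst hik; rw [torsorPt_self, torsorPt_comm f t (R.r j), torsorPt_add_self hC]
  obtain ⟨σ, h0, h1, h2⟩ := exists_perm_fin_four hij hjk hik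
  have h := torsorPt_add_torsorPt_012 hC (R.reindex σ) ha h3 hΔ ht hI hJ
  simpa [h0, h1, h2] using h

end Short

/-! ### Functoriality in the field -/

section Map

variable {R₀ S₀ K L : Type*} [CommRing R₀] [CommRing S₀] [Field K] [Field L] [Algebra R₀ S₀]
  [Algebra R₀ K] [Algebra S₀ K] [IsScalarTower R₀ S₀ K] [Algebra R₀ L] [Algebra S₀ L]
  [IsScalarTower R₀ S₀ L] (W : WeierstrassCurve R₀) (ψ : K →ₐ[S₀] L)

/-- **Functoriality**: applying a field homomorphism `ψ` to the coordinates carries `T(u, v)`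
(computed on `E ⁄ K` from `f`, `t`) to `T(ψu, ψv)` (computed on `E ⁄ L` from `ψf`, `ψt`). In
particular the torsor is Galois-equivariant: `σ(T(u, v)) = T(σu, σv)` when `f`, `t` are fixed by
`σ`. [folklore] -/
theorem map_torsorPt (f : BinaryQuartic K) (t u v : K) :
    Point.map ψ (torsorPt (W.baseChange K).toAffine f t u v) =
      torsorPt (W.baseChange L).toAffine (f.map (ψ : K →+* L)) (ψ t) (ψ u) (ψ v) := by
  have hinj : Function.Injective ψ := (ψ : K →+* L).injective
  by_cases h : u ≠ v ∧ (W.baseChange K).toAffine.Nonsingular (torsX f t u v) 0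
  · have h' : ψ u ≠ ψ v ∧
        (W.baseChange L).toAffine.Nonsingular (torsX (f.map (ψ : K →+* L)) (ψ t) (ψ u) (ψ v)) 0 := by
      refine ⟨fun e ↦ h.1 (hinj e), ?_⟩
      rw [show torsX (f.map (ψ : K →+* L)) (ψ t) (ψ u) (ψ v) = ψ (torsX f t u v) from
        torsX_map (ψ : K →+* L) f t u v, show (0 : L) = ψ 0 from (map_zero ψ).symm]
      exact (baseChange_nonsingular (W := W.toAffine) hinj _ _).mpr h.2
    rw [torsorPt, dif_pos h, torsorPt, dif_pos h', Point.map_some]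
    simp only [Point.some.injEq]
    exact ⟨(torsX_map (ψ : K →+* L) f t u v).symm, map_zero ψ⟩
  · have h' : ¬(ψ u ≠ ψ v ∧
        (W.baseChange L).toAffine.Nonsingular (torsX (f.map (ψ : K →+* L)) (ψ t) (ψ u) (ψ v)) 0) := by
      rintro ⟨hne, hns⟩
      refine h ⟨fun e ↦ hne (congrArg ψ e), ?_⟩
      rw [show torsX (f.map (ψ : K →+* L)) (ψ t) (ψ u) (ψ v) = ψ (torsX f t u v) from
        torsX_map (ψ : K →+* L) f t u v, show (0 : L) = ψ 0 from (map_zero ψ).symm] at hns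
      exact (baseChange_nonsingular (W := W.toAffine) hinj _ _).mp hns
    rw [torsorPt, dif_neg h, torsorPt, dif_neg h', Point.map_zero]

end Map

end TwoCovering

end Literature.NumberTheory.EllipticCurves
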